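import Summits.NavierStokesRegularity.NavierStokesRegularity.Theorems.PumpContinuationEulerProximatePumpSwappedDoor

/-!
# Route PumpContinuation · crux `EulerProximatePump` (stmt-NavierStokesRegularity-18302) — normal form: the Door's datum may be assumed to pump

Support lemmas of the line lead (line `SketchIdeator2`, lead c8, 2026-08-17), continuing
`PumpContinuationEulerProximatePumpSwappedDoor.lean` (closure of Tao's class under real affine combinations
with `B`, `exists_admissible_form_eq_affine`; congruence of blow-ups on the `H¹⁰_df` diagonal,
`tIB_congr_memH10df`). Nothing here closes the item (`--supports`); no statement of the route is changed.
Notation: `tIB[T, M]` = the crux's matrix, `seg[𝒜, θ]` = the segment form `(1-θ)B̃_𝒜 + θB`.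

* `exists_admissible_reparam` — **reparametrising the segment inside Tao's class**: for a symmetric
  cancelling `𝒜` and a real `θ₀` there is a symmetric cancelling `𝒜'` with `B̃_{𝒜'} = (1-θ₀)B̃_𝒜 + θ₀B` on
  finite-`H¹⁰` arguments, hence `seg[𝒜', φ] = seg[𝒜, φ + (1-φ)θ₀]` on the `H¹⁰_df` diagonal: the segment
  of `𝒜'` is the tail `[θ₀, 1]` of the segment of `𝒜`.
* `eulerProximatePump_iff_withPumpingSeed` — **normal form of the Door**: `EulerProximatePump` is
  equivalent to the existence of a symmetric cancelling `𝒜` and a ceiling `M` such that `B̃_𝒜` ITSELF has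
  a Schwartz-data `H¹⁰_df`-mild Type-I blow-up at ceiling `M` with no mild extension AND such blow-ups
  persist along `(1-θ)B̃_𝒜 + θB` for `θ → 1⁻`. So the route's picture "seed at Tao's end `θ = 0` +
  continuation towards the Euler end at bounded temperature" loses no generality for the Door — although
  seed ignition is not class-wide (`EulerProximatePump.Negative.not_forall_admissible_seedIgnited`), it
  can always be arranged for a Door witness, at the same ceiling.

The file ends with the registered Tools stub `stub_swappedDoorToolsB`.

## References

* T. Tao, J. Amer. Math. Soc. 29 (2016), arXiv:1402.0290v3, §1.1 (1.13), (1.15); §3.2 ¶1. [Tao2016AveragedNS]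
-/

noncomputable section

-- the nested summit namespace `…NavierStokesRegularity.NavierStokesRegularity…` is the tree's layout (D-0017)
set_option linter.dupNamespace false

open MeasureTheory Set Filter Topology
open scoped ENNReal
open Literature.Analysis.FluidPDE Literature.Analysis.FluidPDE.Tao2016

namespace Summit.NavierStokesRegularity.NavierStokesRegularity.Theorems.PumpContinuationEulerProximatePump

open Literature.Analysis.FunctionSpaces (eFourierSobolevNorm)

/-- Schwartz-data `H¹⁰_df`-mild Type-I blow-up of the form `T` at ceiling `M` with no mild extension —
verbatim the matrix of the crux (a notation, as in `DoorObstructions.lean`). -/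
local notation3 "tIB[" T ", " M "]" =>
  ∃ u₀ : SchwartzMap (EuclideanSpace ℝ (Fin 3)) (EuclideanSpace ℝ (Fin 3)),
    Literature.Analysis.FluidPDE.VectorCalculus.IsDivFree ⇑u₀ ∧ ∃ S : ℝ, 0 < S ∧
    ∃ u : ℝ → Literature.Analysis.FluidPDE.Tao2016.L2C,
      Literature.Analysis.FluidPDE.Tao2016.IsMildSolutionFor T
        (Literature.Analysis.FluidPDE.Tao2016.schwartzL2 u₀) (Set.Ico 0 S) u ∧
      (∀ t ∈ Set.Ico 0 S, MeasureTheory.eLpNorm (u t) ⊤ MeasureTheory.volume ≤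
        ENNReal.ofReal (M / Real.sqrt (S - t))) ∧
      ¬ ∃ S' : ℝ, S < S' ∧ ∃ v : ℝ → Literature.Analysis.FluidPDE.Tao2016.L2C,
        Literature.Analysis.FluidPDE.Tao2016.IsMildSolutionFor T
          (Literature.Analysis.FluidPDE.Tao2016.schwartzL2 u₀) (Set.Ico 0 S') v ∧
        ∀ t ∈ Set.Ico 0 S, v t = u t

/-- The segment form `T_θ = (1-θ)·B̃_𝒜 + θ·B` of route PumpContinuation (verbatim). -/
local notation3 "seg[" 𝒜 ", " θ "]" =>
  fun (a b c : Literature.Analysis.FluidPDE.Tao2016.L2C) =>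
    ((1 - θ : ℝ) : ℂ) * AveragingDatum.form 𝒜 a b c +
      ((θ : ℝ) : ℂ) * Literature.Analysis.FluidPDE.Tao2016.eulerForm a b c

/-! ### Reparametrising the segment -/

/-- **Reparametrising the segment inside Tao's class.** For a symmetric cancelling datum `𝒜` and a real
`θ₀` there is a symmetric cancelling `𝒜'` with `B̃_{𝒜'} = (1-θ₀)B̃_𝒜 + θ₀B` on finite-`H¹⁰` arguments
(`exists_admissible_form_eq_affine` with `𝒜₂ = euler`), so that on the `H¹⁰_df` diagonal
`seg[𝒜', φ] = seg[𝒜, φ + (1-φ)θ₀]` for every `φ`: the segment of `𝒜'` is the tail `[θ₀, 1]` of the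
segment of `𝒜`, affinely reparametrised (`φ = 0 ↦ θ₀`, `φ = 1 ↦ 1`). [folklore] -/
theorem exists_admissible_reparam {𝒜 : AveragingDatum} (hs : 𝒜.IsSymmetric) (hc : 𝒜.HasCancellation)
    (θ₀ : ℝ) :
    ∃ 𝒜' : AveragingDatum, 𝒜'.IsSymmetric ∧ 𝒜'.HasCancellation ∧
      ∀ φ : ℝ, ∀ p c : L2C, MemH10df p → MemH10df c →
        (seg[𝒜', φ]) p p c = (seg[𝒜, φ + (1 - φ) * θ₀]) p p c := by
  obtain ⟨𝒜', hs', hc', hform⟩ := exists_admissible_form_eq_affine hs hc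
    AveragingDatum.euler_isSymmetric AveragingDatum.euler_hasCancellation (1 - θ₀) θ₀
  refine ⟨𝒜', hs', hc', fun φ p c hp _ => ?_⟩
  show ((1 - φ : ℝ) : ℂ) * 𝒜'.form p p c + ((φ : ℝ) : ℂ) * eulerForm p p c =
    ((1 - (φ + (1 - φ) * θ₀) : ℝ) : ℂ) * 𝒜.form p p c +
      ((φ + (1 - φ) * θ₀ : ℝ) : ℂ) * eulerForm p p c
  rw [hform p p c hp.1 hp.1, AveragingDatum.euler_form]
  push_cast
  ring

/-! ### The Door's datum may be assumed to pump at `θ = 0` -/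

/-- **Normal form of the Door: the datum may be assumed to pump at `θ = 0`, at the same ceiling.**
`EulerProximatePump` is equivalent to the existence of a symmetric cancelling `𝒜` and a ceiling `M` such
that `B̃_𝒜` ITSELF has a Schwartz-data `H¹⁰_df`-mild Type-I blow-up at ceiling `M` with no mild extension
AND bounded-temperature blow-ups at ceiling `M` persist along `(1-θ)B̃_𝒜 + θB` for `θ` arbitrarily close
to `1`. (→): take a hot `θ₀ ∈ [0,1)` of a witness `(𝒜, M)` and pass to the reparametrised datum `𝒜'` of
`exists_admissible_reparam`: `B̃_{𝒜'} = seg[𝒜, θ₀]` on the diagonal is hot, and the tail of the segment of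
`𝒜` beyond `θ₀` is the whole segment of `𝒜'` (for `δ`, use the witness of `𝒜` at `min (δ(1-θ₀)) (1-θ₀)`).
[folklore] -/
theorem eulerProximatePump_iff_withPumpingSeed :
    Theses.PumpContinuation.EulerProximatePump ↔
      ∃ 𝒜 : AveragingDatum, 𝒜.IsSymmetric ∧ 𝒜.HasCancellation ∧ ∃ M : ℝ,
        tIB[AveragingDatum.form 𝒜, M] ∧
        ∀ δ : ℝ, 0 < δ → ∃ θ : ℝ, 1 - δ < θ ∧ θ < 1 ∧ 0 ≤ θ ∧ tIB[seg[𝒜, θ], M] := by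
  constructor
  · rintro ⟨𝒜, hs, hc, M, hM⟩
    obtain ⟨θ₀, -, hθ₀1, -, hhot⟩ := hM 1 one_pos
    obtain ⟨𝒜', hs', hc', hrep⟩ := exists_admissible_reparam hs hc θ₀
    have h1θ₀ : 0 < 1 - θ₀ := by linarith
    refine ⟨𝒜', hs', hc', M, ?_, fun δ hδ => ?_⟩
    · -- the seed: `B̃_{𝒜'} = seg[𝒜', 0] = seg[𝒜, θ₀]` on the diagonal
      have hdiag : ∀ p c : L2C, MemH10df p → MemH10df c →
          𝒜'.form p p c = (seg[𝒜, θ₀]) p p c := by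
        intro p c hp hc''
        have h := hrep 0 p c hp hc''
        rw [show (0 : ℝ) + (1 - 0) * θ₀ = θ₀ by ring] at h
        calc 𝒜'.form p p c
            = ((1 - 0 : ℝ) : ℂ) * 𝒜'.form p p c + (((0 : ℝ) : ℝ) : ℂ) * eulerForm p p c := by
              push_cast
              ring
          _ = _ := h
      exact (tIB_congr_memH10df hdiag M).2 hhot
    · -- the tail: the witness of `𝒜` at `min (δ(1-θ₀)) (1-θ₀)`, pulled back to `𝒜'`
      obtain ⟨θ, hθ1, hθ2, -, hθ⟩ := hM (min (δ * (1 - θ₀)) (1 - θ₀))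
        (lt_min (mul_pos hδ h1θ₀) h1θ₀)
      have hle₁ := min_le_left (δ * (1 - θ₀)) (1 - θ₀)
      have hle₂ := min_le_right (δ * (1 - θ₀)) (1 - θ₀)
      have hq_lt : (1 - θ) / (1 - θ₀) < δ := by
        rw [div_lt_iff₀ h1θ₀]
        linarith
      have hq_pos : 0 < (1 - θ) / (1 - θ₀) := div_pos (by linarith) h1θ₀
      have hq_le : (1 - θ) / (1 - θ₀) ≤ 1 := by
        rw [div_le_one h1θ₀]
        linarith
      have hφθ : (1 - (1 - θ) / (1 - θ₀)) + (1 - (1 - (1 - θ) / (1 - θ₀))) * θ₀ = θ := by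
        field_simp
        ring
      refine ⟨1 - (1 - θ) / (1 - θ₀), by linarith, by linarith, by linarith, ?_⟩
      refine (tIB_congr_memH10df (fun p c hp hc'' => ?_) M).2 hθ
      have h := hrep (1 - (1 - θ) / (1 - θ₀)) p c hp hc''
      rw [hφθ] at h
      exact h
  · rintro ⟨𝒜, hs, hc, M, -, hM⟩
    exact ⟨𝒜, hs, hc, M, hM⟩

/-! ### Registered Tools stub -/

/-- **Registered tools stub `stub_swappedDoorToolsB`** of line `SketchIdeator2` (crux
stmt-NavierStokesRegularity-18302): `eulerProximatePump_iff_withPumpingSeed`, spelled out without notation. [folklore] -/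
theorem stub_swappedDoorToolsB :
    (Summit.NavierStokesRegularity.NavierStokesRegularity.Theses.PumpContinuation.EulerProximatePump ↔ ∃ 𝒜 : Literature.Analysis.FluidPDE.Tao2016.AveragingDatum, 𝒜.IsSymmetric ∧ 𝒜.HasCancellation ∧ ∃ M : ℝ, (∃ u₀ : SchwartzMap (EuclideanSpace ℝ (Fin 3)) (EuclideanSpace ℝ (Fin 3)), Literature.Analysis.FluidPDE.VectorCalculus.IsDivFree ⇑u₀ ∧ ∃ S : ℝ, 0 < S ∧ ∃ u : ℝ → Literature.Analysis.FluidPDE.Tao2016.L2C, Literature.Analysis.FluidPDE.Tao2016.IsMildSolutionFor (Literature.Analysis.FluidPDE.Tao2016.AveragingDatum.form 𝒜) (Literature.Analysis.FluidPDE.Tao2016.schwartzL2 u₀) (Set.Ico 0 S) u ∧ (∀ t ∈ Set.Ico 0 S, MeasureTheory.eLpNorm (u t) ⊤ MeasureTheory.volume ≤ ENNReal.ofReal (M / Real.sqrt (S - t))) ∧ ¬ ∃ S' : ℝ, S < S' ∧ ∃ v : ℝ → Literature.Analysis.FluidPDE.Tao2016.L2C, Literature.Analysis.FluidPDE.Tao2016.IsMildSolutionFor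 (Literature.Analysis.FluidPDE.Tao2016.AveragingDatum.form 𝒜) (Literature.Analysis.FluidPDE.Tao2016.schwartzL2 u₀) (Set.Ico 0 S') v ∧ ∀ t ∈ Set.Ico 0 S, v t = u t) ∧ ∀ δ : ℝ, 0 < δ → ∃ θ : ℝ, 1 - δ < θ ∧ θ < 1 ∧ 0 ≤ θ ∧ ∃ u₀ : SchwartzMap (EuclideanSpace ℝ (Fin 3)) (EuclideanSpace ℝ (Fin 3)), Literature.Analysis.FluidPDE.VectorCalculus.IsDivFree ⇑u₀ ∧ ∃ S : ℝ, 0 < S ∧ ∃ u : ℝ → Literature.Analysis.FluidPDE.Tao2016.L2C, Literature.Analysis.FluidPDE.Tao2016.IsMildSolutionFor (fun a b c => ((1 - θ : ℝ) : ℂ) * 𝒜.form a b c + ((θ : ℝ) : ℂ) * Literature.Analysis.FluidPDE.Tao2016.eulerForm a b c) (Literature.Analysis.FluidPDE.Tao2016.schwartzL2 u₀) (Set.Ico 0 S) u ∧ (∀ t ∈ Set.Ico 0 S, MeasureTheory.eLpNorm (u t) ⊤ MeasureTheory.volume ≤ ENNReal.ofReal (M / Real.sqrt (S - t))) ∧ ¬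 ∃ S' : ℝ, S < S' ∧ ∃ v : ℝ → Literature.Analysis.FluidPDE.Tao2016.L2C, Literature.Analysis.FluidPDE.Tao2016.IsMildSolutionFor (fun a b c => ((1 - θ : ℝ) : ℂ) * 𝒜.form a b c + ((θ : ℝ) : ℂ) * Literature.Analysis.FluidPDE.Tao2016.eulerForm a b c) (Literature.Analysis.FluidPDE.Tao2016.schwartzL2 u₀) (Set.Ico 0 S') v ∧ ∀ t ∈ Set.Ico 0 S, v t = u t) :=
  eulerProximatePump_iff_withPumpingSeed

end Summit.NavierStokesRegularity.NavierStokesRegularity.Theorems.PumpContinuationEulerProximatePump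

end
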